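import Mathlib
import Literature.NumberTheory.Irrationality.Zudilin2004.GroupStructureZeta3
import HarnessLib

/-!
# Zudilin 2004, §2 and §4: the group structure for `ζ(3)` on the CLOSED cone `{b₁,b₂} ≤ {a_j} < {b₃,b₄}`

Topic `Literature/NumberTheory/Irrationality/Zudilin2004`; companion of `GroupStructureZeta3` (same namespace,
disjoint names). Typed, cited statement (ONE named fact, no proof) with PROVED companions, read on the page from
W. Zudilin, *Arithmetic of linear forms involving odd zeta values*, J. Théor. Nombres Bordeaux **16** (2004)
251–291 = arXiv:math/0206176 [Zudilin2004]: Sect. 2, (2.1)–(2.3) (the standing hypothesis on the integral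
parameters `(a;b)`: `{b₁,b₂} ≤ {a₁,a₂,a₃,a₄} < {b₃,b₄}` (2.2) and `a₁+a₂+a₃+a₄ ≤ b₁+b₂+b₃+b₄−2` (2.3)); Sect. 3,
(3.9) (`a₁+…+a₄ = b₁+…+b₄−2`); Sect. 4, Prop. 2 (Bailey's identity [Ba1, (3.4)] = [Sl, (4.7.1.3)], "provided that
the series on the left-hand side converges"), Lemma 7 ("If condition (3.9) holds, then (4.4)") with (4.5)–(4.6),
the paragraph after (4.6) (the permutations `𝔞_jk`, `𝔟₁₂`, `𝔟₃₄` do not change the left-hand side of (4.4), the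
`𝔥_jk` do not change its right-hand side), Lemma 8 with (4.7), and (4.12). HONEST FRAMING (cell pub-zeta5):
systematic search; no irrationality claim unless certified — an identity of special functions, no arithmetic claim
about `ζ(3)` or `ζ(5)`.

## What is printed, and what is typed here
`GroupStructureZeta3` types the `𝔊`-invariance of (4.4), `F̃₅(B)/Π(B) = F̃₅(𝔱B)/Π(𝔱B)`, under ADMISSIBILITY
(4.12): all sixteen parameters `c_jk > 0` (`Admissible`, `baileyTransform`). In the source, (4.12) is introduced
only before Lemma 9, for the arithmetic study of `H(c)`; Lemma 7 itself — the identity (4.4) — is stated for the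
integral parameters (2.1) under the standing hypothesis (2.2) of Sect. 2 and the balancing condition (3.9), and
(2.2) says precisely that the sixteen integers `c_jk` of (4.7), read as the linear forms `a_j − b_k` (`k = 1,2`) and
`b_k − a_j − 1` (`k = 3,4`), are all `≥ 0`. In Brown–Zudilin's coordinates `B` (`h₀ = B₀+2`, `h_j = B_j+1`,
`(a;b)` from `h` by (4.6), for which (3.9) holds identically) these sixteen linear forms are the entries of
`cParams B` (`GroupStructureZeta3`: `B₁,…,B₅`, `2B₀−Σ_jB_j`, `B₀−B_j−B_k`), so (2.2) reads `∀ c ∈ cParams B, 0 ≤ c`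
(`WeakAdmissible`, the CLOSED cone). On this cone the series `F̃₅(B)` converges (the exponent condition is
`2B₀−Σ_jB_j ≥ 0`), the `𝔞_jk`-symmetry of `G̃(a,b)` ((3.1)–(3.2): "do not depend on the order of numbers in the
sets `{a₁,a₂,a₃,a₄}`, `{b₁,b₂}`, and `{b₃,b₄}`") is unconditional, and `𝔊` permutes the `c_jk` (Lemma 8), so the
closed cone is `𝔊`-stable (`weakAdmissible_tau`). READING CAVEAT, recorded for the referee: the proof of Lemma 7
goes through the contour integral of Lemma 5, whose vertical line `Re t = t₁`, `1−a₁* < t₁ < 1−b₂*`, needs the open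
strip to be non-empty; on the faces `a_j = b_k` (`k = 1,2`) of the closed cone the printed argument is completed by
the usual indentation / continuity in the parameters (Prop. 2 is an identity of meromorphic functions of the
parameters, valid whenever the series converges). The statement typed below is the printed Lemma 7 + `𝔞₁₂`
symmetry under the printed standing hypothesis (2.2); nothing beyond the closed cone is claimed.

## Contents
* `WeakAdmissible B` (the closed cone (2.2) in the coordinates `B`; decidable), PROVED bookkeeping:
  `weakAdmissible_of_admissible`, `weakAdmissible_tau`, `weakAdmissible_comp_swap35`;
* NAMED FACT `baileyTransformClosed` (PROVED tree-side: `Summits/KontsevichZagierPeriods/Zeta5Search/VWPOfPosConsequences.lean`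
  `baileyTransformClosed_holds` (p538491) — not restated here because Literature cannot import Summits): for weakly
  admissible `B`,
  `F̃₅(B)/Π(B) = F̃₅(𝔱B)/Π(𝔱B)` [Zudilin2004, Sect. 2 (2.2), Sect. 4 Lemma 7 (4.4)–(4.6) and the paragraph after
  (4.6)];
* PROVED: `baileyTransform_of_closed : baileyTransformClosed → baileyTransform` (the fact of `GroupStructureZeta3`
  is the restriction to the open cone), and `baileyTransformClosed.slots134` (the conjugate generator `𝔱₁₃₄` on the
  closed cone, from the fact and the `S₅`-symmetry `vwpDual_comp_swap`, `piNorm_comp_swap`, `tau134_eq`).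
Use in the cell (pub-zeta5, gen-1 transport step): Brown–Zudilin's own example `a = (1,…,1)` (arXiv:2210.03391,
Sect. 2, the totally symmetric case `a₁ = ⋯ = a₈ = n` at `n = 1`, eq. (5)) produces, at the residue `k = 2` of the
descent (22) of Sect. 6 of that paper, the parameter set `B = (3;1,0,1,1,1)` with `B₂ = 0`, weakly but not strictly
admissible (sanity checks at the end): transporting the terms of (22) to other shapes needs the closed cone.
-/

noncomputable section

open Finset

namespace Literature.NumberTheory.Irrationality.Zudilin2004

open BrownZudilin2022 (vwpDual hOfB)

/-! ### The closed cone (2.2) in the coordinates `B` -/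

/-- WEAKLY ADMISSIBLE parameters: the standing hypothesis (2.2), `{b₁,b₂} ≤ {a₁,a₂,a₃,a₄} < {b₃,b₄}`, for the
integral parameters `(a;b)` attached to `h = (B₀+2; B₁+1,…,B₅+1)` by (4.6) — equivalently, all sixteen linear forms
`c_jk` of (4.7) (`a_j − b_k` for `k = 1,2`, `b_k − a_j − 1` for `k = 3,4`; in the coordinates `B`: the entries of
`cParams B`) are `≥ 0`. The closure of the admissible cone (4.12). [cite: Zudilin2004, Sect. 2, (2.2); Sect. 4, (4.6)–(4.7)] -/
def WeakAdmissible (B : ℕ → ℤ) : Prop := ∀ c ∈ cParams B, 0 ≤ c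

/-- Weak admissibility of concrete parameters is decidable (sixteen integer sign conditions).
[cite: Zudilin2004, Sect. 2, (2.2)] -/
instance (B : ℕ → ℤ) : Decidable (WeakAdmissible B) := by
  unfold WeakAdmissible; infer_instance

/-- The admissible cone (4.12) lies in the closed cone (2.2). [cite: Zudilin2004, Sect. 4, (4.12)] -/
theorem weakAdmissible_of_admissible {B : ℕ → ℤ} (hB : Admissible B) : WeakAdmissible B :=
  fun c hc => le_of_lt (hB c hc)

/-- `𝔱` PERMUTES the sixteen parameters `c_jk` (Lemma 8), hence preserves the closed cone (2.2).
[cite: Zudilin2004, Sect. 4, Lemma 8] -/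
theorem weakAdmissible_tau {B : ℕ → ℤ} (hB : WeakAdmissible B) : WeakAdmissible (tau B) := by
  unfold WeakAdmissible cParams at hB ⊢
  simp only [List.mem_cons, List.not_mem_nil, or_false, forall_eq_or_imp, forall_eq] at hB ⊢
  simp only [tau]
  norm_num
  omega

/-- The closed cone (2.2) is symmetric in `B₁,…,B₅` (here: under the transposition of the slots `3, 5`, which
permutes the `c_jk`). [cite: Zudilin2004, Sect. 4, (4.7)] -/
theorem weakAdmissible_comp_swap35 {B : ℕ → ℤ} (hB : WeakAdmissible B) : WeakAdmissible (B ∘ Equiv.swap 3 5) := by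
  unfold WeakAdmissible cParams at hB ⊢
  simp only [List.mem_cons, List.not_mem_nil, or_false, forall_eq_or_imp, forall_eq] at hB ⊢
  have s0 : Equiv.swap (3 : ℕ) 5 0 = 0 := Equiv.swap_apply_of_ne_of_ne (by norm_num) (by norm_num)
  have s1 : Equiv.swap (3 : ℕ) 5 1 = 1 := Equiv.swap_apply_of_ne_of_ne (by norm_num) (by norm_num)
  have s2 : Equiv.swap (3 : ℕ) 5 2 = 2 := Equiv.swap_apply_of_ne_of_ne (by norm_num) (by norm_num)
  have s4 : Equiv.swap (3 : ℕ) 5 4 = 4 := Equiv.swap_apply_of_ne_of_ne (by norm_num) (by norm_num)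
  have s3 : Equiv.swap (3 : ℕ) 5 3 = 5 := Equiv.swap_apply_left _ _
  have s5 : Equiv.swap (3 : ℕ) 5 5 = 3 := Equiv.swap_apply_right _ _
  simp only [Function.comp, s0, s1, s2, s3, s4, s5]
  omega

/-! ### The named fact: Lemma 7 with the `𝔞₁₂`-symmetry, on the closed cone -/

/-- **Zudilin 2004, Sect. 4 — the group structure for `ζ(3)` via Bailey's transformation, on the closed cone (2.2)**
(named fact; PROVED tree-side: `Summits/KontsevichZagierPeriods/Zeta5Search/VWPOfPosConsequences.lean`
`baileyTransformClosed_holds` (p538491) — not restated here because Literature cannot import Summits). For integer parameters `B = (B₀;B₁,…,B₅)` in the CLOSED cone — all sixteen linear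
forms `c_jk` of (4.7) non-negative, i.e. the standing hypothesis (2.2) `{b₁,b₂} ≤ {a_j} < {b₃,b₄}` of Sect. 2 for
the attached `(a;b)` ((4.6); the balancing condition (3.9) then holds identically) — the quantity (4.4),
`F̃₅(B)/Π(B)` with `Π(B) = ∏_{j=1}^{5}B_j!·(2B₀−Σ_jB_j)!`, is unchanged by the generator `𝔞₁₂`:
`F̃₅(B)/Π(B) = F̃₅(𝔱B)/Π(𝔱B)` for the involution `𝔱` of `tau`. In the source this is Lemma 7 ("If condition (3.9)
holds, then (4.4)", from Bailey's identity, Prop. 2, "provided that the series on the left-hand side converges" —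
here `2B₀ − Σ_jB_j ≥ 0`) combined with the invariance of `G̃(a,b)` under permutations of `a₁,…,a₄` ((3.1)–(3.2));
the strict inequalities (4.12) enter the source only afterwards, for `H(c)` and Lemma 9. Reading caveat (module
docstring): on the faces `a_j = b_k`, `k ≤ 2`, the contour of Lemma 5 is to be indented / the identity obtained by
continuity in the parameters. `baileyTransform` (`GroupStructureZeta3`) is the restriction to the open cone
(`baileyTransform_of_closed`).
[cite: Zudilin2004, Sect. 2 (2.2)–(2.3); Sect. 4, Prop. 2, Lemma 7 with (4.4)–(4.6), the paragraph after (4.6), Lemma 8 (4.7)] -/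
def baileyTransformClosed : Prop :=
  ∀ B : ℕ → ℤ, WeakAdmissible B →
    vwpDual 5 B / (piNorm B : ℝ) = vwpDual 5 (tau B) / (piNorm (tau B) : ℝ)

/-- **PROVED.** The open-cone fact `baileyTransform` of `GroupStructureZeta3` is the restriction of
`baileyTransformClosed` to admissible parameters (4.12). [cite: Zudilin2004, Sect. 4, (4.12) and Lemma 7] -/
theorem baileyTransform_of_closed (hBT : baileyTransformClosed) : baileyTransform :=
  fun B hB => hBT B (weakAdmissible_of_admissible hB)

/-- **Corollary (PROVED from the fact).** The `𝔊`-invariance for the conjugate generator on the slots `{1,3,4}`,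
on the closed cone: for weakly admissible `B`, `F̃₅(B)/Π(B) = F̃₅(𝔱₁₃₄B)/Π(𝔱₁₃₄B)` — the form of the transport
step used in the cell. [cite: Zudilin2004, Sect. 4, paragraph after (4.6) and Lemma 8] -/
theorem baileyTransformClosed.slots134 (hBT : baileyTransformClosed) (B : ℕ → ℤ) (hB : WeakAdmissible B) :
    vwpDual 5 B / (piNorm B : ℝ) = vwpDual 5 (tau134 B) / (piNorm (tau134 B) : ℝ) := by
  have h3 : (3 : ℕ) ∈ Icc 1 5 := by simp
  have h5 : (5 : ℕ) ∈ Icc 1 5 := by simp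
  have hB' := weakAdmissible_comp_swap35 hB
  have step := hBT (B ∘ Equiv.swap 3 5) hB'
  rw [vwpDual_comp_swap 5 B h3 h5, piNorm_comp_swap B h3 h5] at step
  rw [step, tau134_eq, vwpDual_comp_swap 5 _ h3 h5, piNorm_comp_swap _ h3 h5]

/-- `𝔱₁₃₄` preserves the closed cone (it permutes the `c_jk`). [cite: Zudilin2004, Sect. 4, Lemma 8] -/
theorem weakAdmissible_tau134 {B : ℕ → ℤ} (hB : WeakAdmissible B) : WeakAdmissible (tau134 B) := by
  unfold WeakAdmissible cParams at hB ⊢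
  simp only [List.mem_cons, List.not_mem_nil, or_false, forall_eq_or_imp, forall_eq] at hB ⊢
  simp only [tau134]
  norm_num
  omega

/-! ### Sanity checks (not citable): Brown–Zudilin's `a = (1,…,1)`, residue `k = 2`, gives `B = (3;1,0,1,1,1)` -/

example : WeakAdmissible (fun j => (([3, 1, 0, 1, 1, 1] : List ℤ).getD j 0)) := by decide

example : ¬ Admissible (fun j => (([3, 1, 0, 1, 1, 1] : List ℤ).getD j 0)) := by decide

example : (List.range 6).map (tau fun j => (([3, 1, 0, 1, 1, 1] : List ℤ).getD j 0)) = [3, 1, 0, 1, 1, 1] := by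
  decide

example : (List.range 6).map (tau fun j => (([5, 1, 0, 2, 1, 1] : List ℤ).getD j 0)) = [7, 3, 0, 2, 3, 3] := by
  decide

example : WeakAdmissible (fun j => (([5, 1, 0, 2, 1, 1] : List ℤ).getD j 0)) ∧
    ¬ Admissible (fun j => (([5, 1, 0, 2, 1, 1] : List ℤ).getD j 0)) ∧
    WeakAdmissible (tau fun j => (([5, 1, 0, 2, 1, 1] : List ℤ).getD j 0)) := by
  decide

end Literature.NumberTheory.Irrationality.Zudilin2004
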